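import Summits.MatrixMultiplication.MatrixMultiplication.Theorems.AbelianSTPPCensusU11GPrimeWalls
import Summits.MatrixMultiplication.MatrixMultiplication.Theorems.AbelianSTPPCensusFP2Sound
import Summits.MatrixMultiplication.MatrixMultiplication.Theorems.AbelianSTPPCensusTAKnap575Sound
import Summits.MatrixMultiplication.MatrixMultiplication.Theorems.AbelianSTPPCensusSieveRulesReversal
import Summits.MatrixMultiplication.MatrixMultiplication.Theorems.AbelianSTPPCensusGlue

/-!
# The quartet of the abelian STPP census: the typed predicate vM ∧ U11-G′ ∧ E3 ∧ U11-F2 the device certifies against, its soundness, and the glue to rung leaves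

Cell mm-stpp (rung F-M1), PRE-REG v1 band B3 (seat mm-stpp-theory, gen 13; the planner's «one cheap extra that helps tranche 2», HOME/STATUS
2026-08-28T20:51:32Z).  After B3 the census owns four sound necessary conditions on the shape list of an STPP family in a finite abelian group of
order `M`; this file packages them as ONE typed predicate and states the exact shape of the statement a device certificate must prove:

* `QuartetAdm M a b c := SieveAdmissible M a b c ∧ U11GPrime M a b c ∧ TAKnap575.E3Adm M a b c ∧ FP2.FP2Adm M a b c` — vM (the sieve system),
  U11-G′ (Grynkiewicz with the Grynkiewicz–Wang 2026 floor; implies the trio's `U11G`, `quartetAdm_u11G`), E3 (three-room energy), U11-F2 (index-2 fibred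
  Pollard; vacuous unless `M = 2p`);
* `quartetAdm_of_isSTPP`, `quartetSound` — SOUND: the shape data of every `IsSTPP` family with non-empty sets in a finite abelian group `H` is `QuartetAdm |H|`
  (`AbelianTECensus.sieveAdmissible_of_isSTPP`, `u11GPrime_of_isSTPP`, `TAKnap575.e3Adm_of_isSTPP`, `FP2.fp2Adm_of_isSTPP`);
* `QuartetExcludes τ M₀ M₁` — the CERTIFICATE SHAPE for an order range: no shape list with `≥ 2` members that is `QuartetAdm M` beats `τ` at any
  `M₀ < M ≤ M₁` (the device's `not_beats_…` theorems have exactly this form with the trio; tranche 2 replaces the trio by the quartet);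
* `noAbelianSTPPHostUpTo_of_quartet` — GLUE: a rung leaf `NoAbelianSTPPHostUpTo τ M₀` and a quartet certificate for `(M₀, M₁]` give the rung leaf at `M₁`
  (via `AbelianTECensus.noAbelianSTPPHostUpTo_of_two`, as every `…Leaf…Closed` file does);
* `quartetExcludes_mono` — a certificate on a wider range restricts; `quartetAdm_trio` — the quartet implies the trio (so every landed trio certificate is a
  quartet certificate: `quartetExcludes_of_trio`);
* the six wall / witness lists of record are NOT `QuartetAdm` (`not_quartetAdm_668/_3193/_6834/_477/_478/_480`, from `U11GPrimeWall.*`).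
WHAT THIS IS NOT: no certificate is run here and no census number moves; whether the quartet closes any order past the trio's walls is the device's
tranche-2 question (all admissible lists at the order, not the one witness).  No existence claim, no `ω` statement.
-/

set_option linter.dupNamespace false -- `MatrixMultiplication.MatrixMultiplication` (summit = problem, D-0017)
set_option autoImplicit false

namespace Summit.MatrixMultiplication.MatrixMultiplication.Theorems

open Finset Literature.Computability.AlgebraicComplexity

namespace Quartet

variable {N : ℕ}

/-- **The quartet** of necessary conditions of the census after PRE-REG v1 band B3: vM ∧ U11-G′ ∧ E3 ∧ U11-F2 (the last vacuous unless `M = 2p`).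
No claim by itself. [original] -/
def QuartetAdm (M : ℕ) (a b c : Fin N → ℕ) : Prop :=
  SieveAdmissible M a b c ∧ U11GPrime M a b c ∧ TAKnap575.E3Adm M a b c ∧ FP2.FP2Adm M a b c

/-- The quartet implies the trio's U11-G. [bookkeeping] -/
theorem quartetAdm_u11G {M : ℕ} {a b c : Fin N → ℕ} (h : QuartetAdm M a b c) : U11G M a b c := u11G_of_u11GPrime h.2.1

/-- The quartet implies the trio `SieveAdmissible ∧ U11G ∧ E3Adm`. [bookkeeping] -/
theorem quartetAdm_trio {M : ℕ} {a b c : Fin N → ℕ} (h : QuartetAdm M a b c) :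
    SieveAdmissible M a b c ∧ U11G M a b c ∧ TAKnap575.E3Adm M a b c :=
  ⟨h.1, quartetAdm_u11G h, h.2.2.1⟩

/-- **Soundness of the quartet**: the shape data of an STPP family with non-empty sets in a finite abelian group `H` is `QuartetAdm |H|`. [original] -/
theorem quartetAdm_of_isSTPP {H : Type} [AddCommGroup H] [Fintype H] [DecidableEq H] {A B C : Fin N → Finset H} (h : IsSTPP A B C)
    (hne : ∀ i, (A i).Nonempty ∧ (B i).Nonempty ∧ (C i).Nonempty) :
    QuartetAdm (Fintype.card H) (fun i => (A i).card) (fun i => (B i).card) (fun i => (C i).card) :=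
  ⟨AbelianTECensus.sieveAdmissible_of_isSTPP h hne, u11GPrime_of_isSTPP h hne, TAKnap575.e3Adm_of_isSTPP h hne,
    FP2.fp2Adm_of_isSTPP h hne⟩

/-- **`QuartetSound`** in the census's item format. [original] -/
theorem quartetSound : ∀ (H : Type) [AddCommGroup H] [Fintype H] (N : ℕ) (A B C : Fin N → Finset H), IsSTPP A B C →
    (∀ i, (A i).Nonempty ∧ (B i).Nonempty ∧ (C i).Nonempty) →
      QuartetAdm (Fintype.card H) (fun i => (A i).card) (fun i => (B i).card) (fun i => (C i).card) := by
  intro H _ _ N A B C h hne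
  classical
  exact quartetAdm_of_isSTPP h hne

/-- **The certificate shape for an order range `(M₀, M₁]` at tier `τ`**: no shape list with at least two members that is `QuartetAdm M` beats `τ`
at an order `M₀ < M ≤ M₁`.  (A device proves this by a kernel certificate; nothing is proved about it here.) [original] -/
def QuartetExcludes (τ : ℝ) (M₀ M₁ : ℕ) : Prop :=
  ∀ (N M : ℕ) (a b c : Fin N → ℕ), 2 ≤ N → M₀ < M → M ≤ M₁ → QuartetAdm M a b c → ¬ Beats τ M a b c

/-- A quartet certificate restricts to a sub-range. [bookkeeping] -/
theorem quartetExcludes_mono {τ : ℝ} {M₀ M₁ M₀' M₁' : ℕ} (h : QuartetExcludes τ M₀ M₁) (h0 : M₀ ≤ M₀') (h1 : M₁' ≤ M₁) :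
    QuartetExcludes τ M₀' M₁' :=
  fun N M a b c hN hlo hhi hq => h N M a b c hN (by omega) (by omega) hq

/-- Every trio certificate (the shape of the landed `not_beats_…` theorems) is a quartet certificate. [bookkeeping] -/
theorem quartetExcludes_of_trio {τ : ℝ} {M₀ M₁ : ℕ}
    (h : ∀ (N M : ℕ) (a b c : Fin N → ℕ), 2 ≤ N → M₀ < M → M ≤ M₁ →
      SieveAdmissible M a b c → U11G M a b c → TAKnap575.E3Adm M a b c → ¬ Beats τ M a b c) :
    QuartetExcludes τ M₀ M₁ :=
  fun N M a b c hN hlo hhi hq => h N M a b c hN hlo hhi hq.1 (quartetAdm_u11G hq) hq.2.2.1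

/-- **Glue**: a rung leaf at `M₀` and a quartet certificate for `(M₀, M₁]` give the rung leaf at `M₁` (`0 < τ ≤ 3`). [original] -/
theorem noAbelianSTPPHostUpTo_of_quartet {τ : ℝ} (hτ0 : 0 < τ) (hτ3 : τ ≤ 3) {M₀ M₁ : ℕ}
    (hleaf : NoAbelianSTPPHostUpTo τ M₀) (hcert : QuartetExcludes τ M₀ M₁) : NoAbelianSTPPHostUpTo τ M₁ := by
  classical
  refine AbelianTECensus.noAbelianSTPPHostUpTo_of_two hτ0 hτ3 ?_
  intro H _ _ hM N A B C hS hne hN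
  by_cases h0 : Fintype.card H ≤ M₀
  · exact hleaf H h0 N A B C hS
  · have hq := quartetAdm_of_isSTPP hS hne
    have h := hcert N (Fintype.card H) _ _ _ hN (by omega) hM hq
    unfold Beats at h
    rw [not_lt] at h
    simpa [shapeVol] using h

/-! ### The six lists of record are not quartet-admissible -/

/-- T_D 668: `(7,7,8)⁴ + (7,7,7)` is not `QuartetAdm 668` (U11-G′). [original] -/
theorem not_quartetAdm_668 : ¬ QuartetAdm 668 (![7, 7, 7, 7, 7] : Fin 5 → ℕ) ![7, 7, 7, 7, 7] ![8, 8, 8, 8, 7] :=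
  fun h => U11GPrimeWall.w668_not_u11GPrime h.2.1

/-- T_C 3193: `(12,12,13)⁶ + (12,12,12) + (11,11,11)` is not `QuartetAdm 3193` (U11-G′). [original] -/
theorem not_quartetAdm_3193 : ¬ QuartetAdm 3193 (![12, 12, 12, 12, 12, 12, 12, 11] : Fin 8 → ℕ) ![12, 12, 12, 12, 12, 12, 12, 11]
    ![13, 13, 13, 13, 13, 13, 12, 11] :=
  fun h => U11GPrimeWall.w3193_not_u11GPrime h.2.1

/-- T_A 6834: `(15,15,18) + (15,16,16)⁵ + (16,16,15)⁴` is not `QuartetAdm 6834` (U11-G′). [original] -/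
theorem not_quartetAdm_6834 : ¬ QuartetAdm 6834 (![15, 15, 15, 15, 15, 15, 16, 16, 16, 16] : Fin 10 → ℕ)
    ![15, 16, 16, 16, 16, 16, 16, 16, 16, 16] ![18, 16, 16, 16, 16, 16, 15, 15, 15, 15] :=
  fun h => U11GPrimeWall.w6834_not_u11GPrime h.2.1

/-- T_E 477: `(8,6,6)⁴ + (5,4,3)` is not `QuartetAdm 477` (U11-G′). [original] -/
theorem not_quartetAdm_477 : ¬ QuartetAdm 477 (![8, 8, 8, 8, 5] : Fin 5 → ℕ) ![6, 6, 6, 6, 4] ![6, 6, 6, 6, 3] :=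
  fun h => U11GPrimeWall.w477_not_u11GPrime h.2.1

/-- T_E 478: `(6,6,8)⁴ + (4,5,3)` is not `QuartetAdm 478` (U11-G′; also U11-F2, `FP2.not_fp2Adm_478`). [original] -/
theorem not_quartetAdm_478 : ¬ QuartetAdm 478 (![6, 6, 6, 6, 4] : Fin 5 → ℕ) ![6, 6, 6, 6, 5] ![8, 8, 8, 8, 3] :=
  fun h => U11GPrimeWall.w478_not_u11GPrime h.2.1

/-- T_E 480: `(8,6,6)⁴ + (4,4,4)` is not `QuartetAdm 480` (U11-G′). [original] -/
theorem not_quartetAdm_480 : ¬ QuartetAdm 480 (![8, 8, 8, 8, 4] : Fin 5 → ℕ) ![6, 6, 6, 6, 4] ![6, 6, 6, 6, 4] :=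
  fun h => U11GPrimeWall.w480_not_u11GPrime h.2.1

end Quartet

end Summit.MatrixMultiplication.MatrixMultiplication.Theorems
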